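import Literature.Geometry.Lorentzian.CoordBianchi
import HarnessLib

/-!
# The Ricci form of metric components as a smooth function of their 2-jet

Fourth layer of the coordinate tensor calculus of `CoordCurvature.lean` / `CoordBianchi.lean` /
`CoordMetricVariation.lean` (metric components `G : E → (E →L E →L ℝ)` on a finite-dimensional
real normed space `E`). The Ricci form `ricAt G x` (O'Neill 1983, Ch. 3, Lemma 3.52:
`Ric = ∂Γ − ∂Γ + ΓΓ − ΓΓ` contracted, `Γ = ½ g⁻¹ ∂g`) is a universal expression in the value
`G x`, the first derivative `DG x` and the second derivative `D²G x`. This file makes that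
statement usable in the form needed to differentiate an evolution equation `∂ₜG = −2 Ric(G)`
arbitrarily often in time (Topping 2006, p. 47: "write `∂ᵏg/∂tᵏ` in terms of the curvature and
its spacial derivatives"; the junction step of the proof of Thm. 5.3.1, carried out in
`Riemannian/RicciFlowCurvatureBlowupJunction.lean`):

* `MetricCoord.taylor2 y₀ A D₁ D₂` — the quadratic field with 2-jet `(A, D₁, D₂)` at `y₀`; its
  jet (`taylor2_self`, `fderiv_taylor2_self`, `fderiv_fderiv_taylor2`), its joint smoothness in
  all data (`contDiff_taylor2`, `contDiff_fderiv_taylor2`), and `isMetricOn_taylor2`;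
* `MetricCoord.ricAt_eq_of_jet_eq` — **`Ric(G)(x)` depends only on the 2-jet of `G` at `x`**;
* `MetricCoord.ricciJet j` — `Ric` as a function on the jet space
  `Jet₂ = E × (E →L E →L ℝ) × (E →L (E →L E →L ℝ)) × (E →L E →L (E →L E →L ℝ))`, with
  `ricAt_eq_ricciJet : ricAt G x = ricciJet (x, G x, DG x, D²G x)`;
* `MetricCoord.contDiffOn_ricciJet` — **`ricciJet` is `C^∞` on the open set
  `{j | j.2.1 invertible}`** (`isOpen_ricciJetDomain`): `♯ = A⁻¹` is smooth on invertible forms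
  (Mathlib's `ContinuousLinearMap.IsInvertible.contDiffAt_map_inverse`), the Christoffel map of
  the Taylor field is smooth jointly in (jet, point) (`contDiffAt_chrTaylor`), hence so is its
  derivative in the point (`ContDiffAt.fderiv`), and `Ric` is a finite sum of their components.

Everything is proved; no definition of `Prop` type and no `sorry` is introduced.

## References

* B. O'Neill, *Semi-Riemannian geometry with applications to relativity*, Academic Press 1983,
  Ch. 3, Prop. 3.13, Lemma 3.38, Lemma 3.52. [ONeill1983]
* P. Topping, *Lectures on the Ricci flow*, LMS Lecture Note Series 325, CUP 2006, §5.3, p. 47.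
  [Topping2006]
-/

noncomputable section

set_option maxSynthPendingDepth 3

open Set Filter Function
open scoped Topology ContDiff

namespace Literature.Geometry.Lorentzian

namespace MetricCoord

variable {E : Type*} [NormedAddCommGroup E] [NormedSpace ℝ E]

/-- The space of 2-jets `(y₀, A, D₁, D₂)` of metric components (local notation). -/
local notation "Jet₂" => E × (E →L[ℝ] E →L[ℝ] ℝ) × (E →L[ℝ] E →L[ℝ] E →L[ℝ] ℝ)
  × (E →L[ℝ] E →L[ℝ] E →L[ℝ] E →L[ℝ] ℝ)

/-- The quadratic field `y ↦ A + D₁(y - y₀) + ½ D₂(y - y₀, y - y₀)` with prescribed 2-jet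
`(A, D₁, D₂)` at `y₀` (Taylor polynomial of order two of metric components). [folklore] -/
def taylor2 (y₀ : E) (A : E →L[ℝ] E →L[ℝ] ℝ) (D₁ : E →L[ℝ] E →L[ℝ] E →L[ℝ] ℝ)
    (D₂ : E →L[ℝ] E →L[ℝ] E →L[ℝ] E →L[ℝ] ℝ) (y : E) : E →L[ℝ] E →L[ℝ] ℝ :=
  A + D₁ (y - y₀) + (2⁻¹ : ℝ) • D₂ (y - y₀) (y - y₀)

variable {y₀ y : E} {A : E →L[ℝ] E →L[ℝ] ℝ} {D₁ : E →L[ℝ] E →L[ℝ] E →L[ℝ] ℝ}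
  {D₂ : E →L[ℝ] E →L[ℝ] E →L[ℝ] E →L[ℝ] ℝ}

/-- The value of the Taylor field at its centre. [folklore] -/
@[simp]
theorem taylor2_self : taylor2 y₀ A D₁ D₂ y₀ = A := by
  simp [taylor2]

/-- The derivative of the Taylor field: `D₁ + ½ (D₂(y - y₀, ·) + D₂(·, y - y₀))`. [folklore] -/
theorem hasFDerivAt_taylor2 (y : E) :
    HasFDerivAt (taylor2 y₀ A D₁ D₂) (D₁ + (2⁻¹ : ℝ) • (D₂ (y - y₀) + D₂.flip (y - y₀))) y := by
  have hL : HasFDerivAt (fun y : E ↦ y - y₀) (ContinuousLinearMap.id ℝ E) y :=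
    (hasFDerivAt_id y).sub_const y₀
  have h1 : HasFDerivAt (fun y ↦ D₁ (y - y₀)) (D₁.comp (ContinuousLinearMap.id ℝ E)) y :=
    D₁.hasFDerivAt.comp y hL
  have hc : HasFDerivAt (fun y ↦ D₂ (y - y₀)) (D₂.comp (ContinuousLinearMap.id ℝ E)) y :=
    D₂.hasFDerivAt.comp y hL
  have h2 : HasFDerivAt (fun y ↦ D₂ (y - y₀) (y - y₀))
      ((D₂ (y - y₀)).comp (ContinuousLinearMap.id ℝ E)
        + (D₂.comp (ContinuousLinearMap.id ℝ E)).flip (y - y₀)) y := hc.clm_apply hL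
  have h := ((hasFDerivAt_const A y).add h1).add (h2.const_smul (2⁻¹ : ℝ))
  have heq : (0 : E →L[ℝ] E →L[ℝ] E →L[ℝ] ℝ) + D₁.comp (ContinuousLinearMap.id ℝ E)
      + (2⁻¹ : ℝ) • ((D₂ (y - y₀)).comp (ContinuousLinearMap.id ℝ E)
        + (D₂.comp (ContinuousLinearMap.id ℝ E)).flip (y - y₀))
      = D₁ + (2⁻¹ : ℝ) • (D₂ (y - y₀) + D₂.flip (y - y₀)) := by
    simp only [ContinuousLinearMap.comp_id, zero_add]
  rw [heq] at h
  exact h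

/-- `fderiv` form of `hasFDerivAt_taylor2`. [folklore] -/
theorem fderiv_taylor2 :
    fderiv ℝ (taylor2 y₀ A D₁ D₂) = fun y ↦ D₁ + (2⁻¹ : ℝ) • (D₂ (y - y₀) + D₂.flip (y - y₀)) :=
  funext fun y ↦ (hasFDerivAt_taylor2 y).fderiv

/-- The first derivative of the Taylor field at its centre is `D₁`. [folklore] -/
theorem fderiv_taylor2_self : fderiv ℝ (taylor2 y₀ A D₁ D₂) y₀ = D₁ := by
  rw [fderiv_taylor2]
  simp only [sub_self, map_zero, add_zero]
  ext v a c
  simp [_root_.add_apply, _root_.smul_apply]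

/-- The second derivative of the Taylor field is the symmetrisation of `D₂`. [folklore] -/
theorem hasFDerivAt_fderiv_taylor2 (y : E) :
    HasFDerivAt (fderiv ℝ (taylor2 y₀ A D₁ D₂)) ((2⁻¹ : ℝ) • (D₂ + D₂.flip)) y := by
  rw [fderiv_taylor2]
  have hL : HasFDerivAt (fun y : E ↦ y - y₀) (ContinuousLinearMap.id ℝ E) y :=
    (hasFDerivAt_id y).sub_const y₀
  have h1 : HasFDerivAt (fun y ↦ D₂ (y - y₀)) (D₂.comp (ContinuousLinearMap.id ℝ E)) y :=
    D₂.hasFDerivAt.comp y hL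
  have h2 : HasFDerivAt (fun y ↦ D₂.flip (y - y₀)) (D₂.flip.comp (ContinuousLinearMap.id ℝ E)) y :=
    D₂.flip.hasFDerivAt.comp y hL
  have h := ((h1.add h2).const_smul (2⁻¹ : ℝ)).const_add D₁
  have heq : (2⁻¹ : ℝ) • (D₂.comp (ContinuousLinearMap.id ℝ E) + D₂.flip.comp (ContinuousLinearMap.id ℝ E))
      = (2⁻¹ : ℝ) • (D₂ + D₂.flip) := by
    simp only [ContinuousLinearMap.comp_id]
  rw [heq] at h
  exact h

/-- The second derivative of the Taylor field is `D₂` when `D₂` is symmetric in its two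
differentiation slots. [folklore] -/
theorem fderiv_fderiv_taylor2 (hD₂ : ∀ v w, D₂ v w = D₂ w v) (y : E) :
    fderiv ℝ (fderiv ℝ (taylor2 y₀ A D₁ D₂)) y = D₂ := by
  rw [(hasFDerivAt_fderiv_taylor2 y).fderiv]
  have hflip : D₂.flip = D₂ :=
    ContinuousLinearMap.ext fun v ↦ ContinuousLinearMap.ext fun w ↦ by
      rw [ContinuousLinearMap.flip_apply, hD₂ w v]
  rw [hflip, ← two_smul ℝ D₂, smul_smul, inv_mul_cancel₀ two_ne_zero, one_smul]

/-- The Taylor field is `C^∞` jointly in the jet data, the centre and the point. [folklore] -/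
theorem contDiff_taylor2 :
    ContDiff ℝ ∞ (fun q : Jet₂ × E ↦ taylor2 q.1.1 q.1.2.1 q.1.2.2.1 q.1.2.2.2 q.2) := by
  unfold taylor2
  have hy : ContDiff ℝ ∞ (fun q : Jet₂ × E ↦ q.2 - q.1.1) :=
    contDiff_snd.sub (contDiff_fst.comp contDiff_fst)
  have hA : ContDiff ℝ ∞ (fun q : Jet₂ × E ↦ q.1.2.1) :=
    (contDiff_fst.comp contDiff_snd).comp contDiff_fst
  have hD₁ : ContDiff ℝ ∞ (fun q : Jet₂ × E ↦ q.1.2.2.1) :=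
    ((contDiff_fst.comp contDiff_snd).comp contDiff_snd).comp contDiff_fst
  have hD₂ : ContDiff ℝ ∞ (fun q : Jet₂ × E ↦ q.1.2.2.2) :=
    ((contDiff_snd.comp contDiff_snd).comp contDiff_snd).comp contDiff_fst
  exact (hA.add (hD₁.clm_apply hy)).add (((hD₂.clm_apply hy).clm_apply hy).const_smul _)

/-- The first derivative of the Taylor field is `C^∞` jointly in the jet data, the centre and
the point. [folklore] -/
theorem contDiff_fderiv_taylor2 :
    ContDiff ℝ ∞ (fun q : Jet₂ × E ↦ fderiv ℝ (taylor2 q.1.1 q.1.2.1 q.1.2.2.1 q.1.2.2.2) q.2) := by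
  simp only [fderiv_taylor2]
  have hy : ContDiff ℝ ∞ (fun q : Jet₂ × E ↦ q.2 - q.1.1) :=
    contDiff_snd.sub (contDiff_fst.comp contDiff_fst)
  have hD₁ : ContDiff ℝ ∞ (fun q : Jet₂ × E ↦ q.1.2.2.1) :=
    ((contDiff_fst.comp contDiff_snd).comp contDiff_snd).comp contDiff_fst
  have hD₂ : ContDiff ℝ ∞ (fun q : Jet₂ × E ↦ q.1.2.2.2) :=
    ((contDiff_snd.comp contDiff_snd).comp contDiff_snd).comp contDiff_fst
  -- `D₂.flip z = (ev_z) ∘ D₂`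
  have hflip : ContDiff ℝ ∞ (fun q : Jet₂ × E ↦ q.1.2.2.2.flip (q.2 - q.1.1)) := by
    have heq : (fun q : Jet₂ × E ↦ q.1.2.2.2.flip (q.2 - q.1.1)) = fun q ↦
        (ContinuousLinearMap.apply ℝ (E →L[ℝ] E →L[ℝ] ℝ) (q.2 - q.1.1)).comp q.1.2.2.2 := by
      funext q
      ext v a c
      rfl
    rw [heq]
    exact ((ContinuousLinearMap.apply ℝ (E →L[ℝ] E →L[ℝ] ℝ)).contDiff.comp hy).clm_comp hD₂
  exact hD₁.add (((hD₂.clm_apply hy).add hflip).const_smul _)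

/-- **A quadratic field with the 2-jet of metric components is a field of metric components
near its centre**: if `A` is symmetric and invertible and `D₁ v`, `D₂ v w` are symmetric
bilinear forms, the Taylor field is smooth, symmetric and nondegenerate on the open set where
it is invertible (which contains `y₀`). [folklore] -/
theorem isMetricOn_taylor2 [CompleteSpace E] (hA : ∀ v w, A v w = A w v)
    (hD₁ : ∀ z v w, D₁ z v w = D₁ z w v) (hD₂ : ∀ z z' v w, D₂ z z' v w = D₂ z z' w v) :
    IsMetricOn (taylor2 y₀ A D₁ D₂) {y | (taylor2 y₀ A D₁ D₂ y).IsInvertible} where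
  isOpen := by
    have hset : {y | (taylor2 y₀ A D₁ D₂ y).IsInvertible} = taylor2 y₀ A D₁ D₂ ⁻¹'
        (range ((↑) : (E ≃L[ℝ] (E →L[ℝ] ℝ)) → E →L[ℝ] E →L[ℝ] ℝ)) := by
      ext y
      simp only [mem_setOf_eq, mem_preimage, mem_range, ContinuousLinearMap.IsInvertible]
    rw [hset]
    have hcont : Continuous (taylor2 y₀ A D₁ D₂) := by
      have h := contDiff_taylor2 (E := E)
      exact (h.continuous.comp (Continuous.prodMk_right (y₀, A, D₁, D₂)) :)
    exact ContinuousLinearEquiv.isOpen.preimage hcont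
  contDiffOn := by
    have h := contDiff_taylor2 (E := E)
    exact (h.comp (contDiff_prodMk_right (y₀, A, D₁, D₂))).contDiffOn
  symm y _ v w := by
    simp only [taylor2, _root_.add_apply, _root_.smul_apply, hA v w, hD₁ _ v w, hD₂ _ _ v w]
  isInvertible y hy := hy

/-- **The Ricci form as a function of the point and the 2-jet**: `Ric` of the Taylor field with
jet `(A, D₁, D₂)` at `y₀`, evaluated at `y₀` (`MetricCoord.ricAt`). [folklore] -/
def ricciJet [FiniteDimensional ℝ E] (j : Jet₂) : E →L[ℝ] E →L[ℝ] ℝ :=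
  ricAt (taylor2 j.1 j.2.1 j.2.2.1 j.2.2.2) j.1

/-- **The Ricci form of metric components depends only on their 2-jet**: two fields of metric
components (smooth, symmetric, nondegenerate near `x`) with the same value, first and second
derivative at `x` have the same Ricci form at `x` (`Ric` is built from `♯ = G⁻¹`, `DG` and
`D²G` at the point: O'Neill 1983, Ch. 3, Lemma 3.38 and Lemma 3.52). [cite: ONeill1983, Ch. 3, Lemma 3.52] -/
theorem ricAt_eq_of_jet_eq [CompleteSpace E] [FiniteDimensional ℝ E]
    {G₁ G₂ : E → E →L[ℝ] E →L[ℝ] ℝ} {V₁ V₂ : Set E} {x : E}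
    (hG₁ : IsMetricOn G₁ V₁) (hG₂ : IsMetricOn G₂ V₂) (hx₁ : x ∈ V₁) (hx₂ : x ∈ V₂)
    (h0 : G₁ x = G₂ x) (h1 : fderiv ℝ G₁ x = fderiv ℝ G₂ x)
    (h2 : fderiv ℝ (fderiv ℝ G₁) x = fderiv ℝ (fderiv ℝ G₂) x) : ricAt G₁ x = ricAt G₂ x := by
  -- `♯`, `K` and `Γ` at `x`
  have hsharp : sharpAt G₁ x = sharpAt G₂ x := by simp only [sharpAt, h0]
  have hkos : koszulCLM G₁ x = koszulCLM G₂ x := by simp only [koszulCLM, h1]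
  have hchr : chrAt G₁ x = chrAt G₂ x := by simp only [chrAt, hsharp, hkos]
  -- derivatives of `♯`, `K` at `x`
  have hDsharp : fderiv ℝ (sharpAt G₁) x = fderiv ℝ (sharpAt G₂) x := by
    ext W α
    rw [hG₁.fderiv_sharpAt hx₁ W, hG₂.fderiv_sharpAt hx₂ W, hsharp, h1]
  have hDkos : fderiv ℝ (koszulCLM G₁) x = fderiv ℝ (koszulCLM G₂) x := by
    rw [(hG₁.hasFDerivAt_koszulCLM hx₁).fderiv, (hG₂.hasFDerivAt_koszulCLM hx₂).fderiv, h2]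
  -- derivative of `Γ = Φ ∘ (♯, K)` with `Φ` bilinear
  have hDchr : fderiv ℝ (chrAt G₁) x = fderiv ℝ (chrAt G₂) x := by
    set Φ : ((E →L[ℝ] ℝ) →L[ℝ] E) × (E →L[ℝ] E →L[ℝ] E →L[ℝ] ℝ) → (E →L[ℝ] E →L[ℝ] E) :=
      fun q ↦ (2⁻¹ : ℝ) • ((ContinuousLinearMap.compL ℝ E (E →L[ℝ] ℝ) E q.1).comp q.2) with hΦ
    have hΦd : ContDiff ℝ ∞ Φ :=
      (((ContinuousLinearMap.compL ℝ E (E →L[ℝ] ℝ) E).contDiff.comp contDiff_fst).clm_comp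
        contDiff_snd).const_smul _
    have he₁ : chrAt G₁ = Φ ∘ fun y ↦ (sharpAt G₁ y, koszulCLM G₁ y) := by
      funext y; simp [hΦ, chrAt]
    have he₂ : chrAt G₂ = Φ ∘ fun y ↦ (sharpAt G₂ y, koszulCLM G₂ y) := by
      funext y; simp [hΦ, chrAt]
    have hp₁ : DifferentiableAt ℝ (fun y ↦ (sharpAt G₁ y, koszulCLM G₁ y)) x :=
      (hG₁.differentiableAt_sharpAt hx₁).prodMk (hG₁.differentiableAt_koszulCLM hx₁)
    have hp₂ : DifferentiableAt ℝ (fun y ↦ (sharpAt G₂ y, koszulCLM G₂ y)) x :=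
      (hG₂.differentiableAt_sharpAt hx₂).prodMk (hG₂.differentiableAt_koszulCLM hx₂)
    have hpx : (sharpAt G₁ x, koszulCLM G₁ x) = (sharpAt G₂ x, koszulCLM G₂ x) := by
      rw [hsharp, hkos]
    have hDp : fderiv ℝ (fun y ↦ (sharpAt G₁ y, koszulCLM G₁ y)) x =
        fderiv ℝ (fun y ↦ (sharpAt G₂ y, koszulCLM G₂ y)) x := by
      rw [(hG₁.differentiableAt_sharpAt hx₁).fderiv_prodMk (hG₁.differentiableAt_koszulCLM hx₁),
        (hG₂.differentiableAt_sharpAt hx₂).fderiv_prodMk (hG₂.differentiableAt_koszulCLM hx₂),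
        hDsharp, hDkos]
    rw [he₁, he₂, fderiv_comp x ((hΦd.differentiable (by simp)) _) hp₁,
      fderiv_comp x ((hΦd.differentiable (by simp)) _) hp₂, hpx, hDp]
  -- curvature and Ricci
  have hriem : ∀ X Y, riemAt G₁ x X Y = riemAt G₂ x X Y := fun X Y ↦ by
    simp only [riemAt, hchr, hDchr]
  ext Y Z
  rw [ricAt_apply, ricAt_apply]
  congr 1
  ext X
  simp only [ricciEndo_apply, hriem]

/-- **`Ric(G)(x)` is the Ricci jet function of the 2-jet of `G` at `x`.**
[cite: ONeill1983, Ch. 3, Lemma 3.52] -/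
theorem ricAt_eq_ricciJet [CompleteSpace E] [FiniteDimensional ℝ E]
    {G : E → E →L[ℝ] E →L[ℝ] ℝ} {V : Set E} {x : E} (hG : IsMetricOn G V) (hx : x ∈ V) :
    ricAt G x = ricciJet (x, G x, fderiv ℝ G x, fderiv ℝ (fderiv ℝ G) x) := by
  have hT := isMetricOn_taylor2 (y₀ := x) (A := G x) (D₁ := fderiv ℝ G x)
    (D₂ := fderiv ℝ (fderiv ℝ G) x) (hG.symm x hx) (hG.fderiv_symm hx) (hG.fderiv_fderiv_symm hx)
  have hxT : x ∈ {y | (taylor2 x (G x) (fderiv ℝ G x) (fderiv ℝ (fderiv ℝ G) x) y).IsInvertible} := by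
    simp only [mem_setOf_eq, taylor2_self]
    exact hG.isInvertible x hx
  unfold ricciJet
  exact ricAt_eq_of_jet_eq hG hT hx hxT (taylor2_self).symm fderiv_taylor2_self.symm
    (fderiv_fderiv_taylor2 (hG.fderiv_fderiv_comm hx) x).symm

/-- The domain of the Ricci jet function: jets with invertible value. It is open. [folklore] -/
theorem isOpen_ricciJetDomain [CompleteSpace E] :
    IsOpen {j : Jet₂ | j.2.1.IsInvertible} := by
  have hset : {j : Jet₂ | j.2.1.IsInvertible} = (fun j : Jet₂ ↦ j.2.1) ⁻¹'
        (range ((↑) : (E ≃L[ℝ] (E →L[ℝ] ℝ)) → E →L[ℝ] E →L[ℝ] ℝ)) := by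
    ext j
    simp only [mem_setOf_eq, mem_preimage, mem_range, ContinuousLinearMap.IsInvertible]
  rw [hset]
  exact ContinuousLinearEquiv.isOpen.preimage (continuous_fst.comp continuous_snd)

/-- The Christoffel map of the Taylor field as a function of (jet data, point). [folklore] -/
def chrTaylor [CompleteSpace E] (q : Jet₂ × E) : E →L[ℝ] E →L[ℝ] E :=
  chrAt (taylor2 q.1.1 q.1.2.1 q.1.2.2.1 q.1.2.2.2) q.2

/-- The Christoffel map of the Taylor field is `C^∞` in (jet data, point) at the points where
the Taylor field is invertible. [folklore] -/
theorem contDiffAt_chrTaylor [CompleteSpace E] {q₀ : Jet₂ × E}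
    (hq₀ : (taylor2 q₀.1.1 q₀.1.2.1 q₀.1.2.2.1 q₀.1.2.2.2 q₀.2).IsInvertible) :
    ContDiffAt ℝ ∞ (chrTaylor (E := E)) q₀ := by
  have hP := contDiff_taylor2 (E := E)
  have hP₁ := contDiff_fderiv_taylor2 (E := E)
  -- `♯` of the Taylor field
  have hsharp : ContDiffAt ℝ ∞
      (fun q : Jet₂ × E ↦ sharpAt (taylor2 q.1.1 q.1.2.1 q.1.2.2.1 q.1.2.2.2) q.2) q₀ := by
    unfold sharpAt
    exact hq₀.contDiffAt_map_inverse.comp q₀ hP.contDiffAt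
  -- the Koszul form of the Taylor field
  have hkos : ContDiffAt ℝ ∞
      (fun q : Jet₂ × E ↦ koszulCLM (taylor2 q.1.1 q.1.2.1 q.1.2.2.1 q.1.2.2.2) q.2) q₀ := by
    unfold koszulCLM
    exact (koszulOp.contDiff.comp hP₁).contDiffAt
  have hL : ContDiffAt ℝ ∞ (fun q : Jet₂ × E ↦ ContinuousLinearMap.compL ℝ E (E →L[ℝ] ℝ) E
      (sharpAt (taylor2 q.1.1 q.1.2.1 q.1.2.2.1 q.1.2.2.2) q.2)) q₀ :=
    (ContinuousLinearMap.compL ℝ E (E →L[ℝ] ℝ) E).contDiff.contDiffAt.comp q₀ hsharp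
  unfold chrTaylor chrAt
  exact (hL.clm_comp hkos).const_smul _

/-- **The Ricci jet function is `C^∞`** on its (open) domain: `♯` is smooth on invertible forms,
the Christoffel map of the Taylor field is smooth jointly in (jet, point), hence so is its
derivative in the point (`ContDiffAt.fderiv`), and `Ric` is a trace of the resulting expressions.
[folklore] -/
theorem contDiffOn_ricciJet [CompleteSpace E] [FiniteDimensional ℝ E] :
    ContDiffOn ℝ ∞ (ricciJet (E := E)) {j : Jet₂ | j.2.1.IsInvertible} := by
  classical
  set b := Module.finBasis ℝ E with hb
  -- the components `Ric(Y, Z) = Σᵢ bⁱ(R(bᵢ, Y) Z)` through `chrTaylor` and its `y`-derivative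
  have hfun : ∀ Y Z : E, (fun j : Jet₂ ↦ ricciJet j Y Z) = fun j ↦
      ∑ i, b.coord i (fderiv ℝ (fun y ↦ chrTaylor (j, y)) j.1 (b i) Y Z
        - fderiv ℝ (fun y ↦ chrTaylor (j, y)) j.1 Y (b i) Z
        + chrTaylor (j, j.1) (b i) (chrTaylor (j, j.1) Y Z)
        - chrTaylor (j, j.1) Y (chrTaylor (j, j.1) (b i) Z)) := by
    intro Y Z
    funext j
    rw [ricciJet, ricAt_eq_sum_coord b]
    rfl
  refine contDiffOn_clm_apply.2 fun Y ↦ contDiffOn_clm_apply.2 fun Z ↦ ?_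
  rw [hfun Y Z]
  intro j hj
  have hj' : (taylor2 j.1 j.2.1 j.2.2.1 j.2.2.2 j.1).IsInvertible := by
    rw [taylor2_self]; exact hj
  have hΨ : ContDiffAt ℝ ∞ (chrTaylor (E := E)) (j, j.1) := contDiffAt_chrTaylor (q₀ := (j, j.1)) hj'
  have hι : ContDiffAt ℝ ∞ (fun j : Jet₂ ↦ ((j, j.1) : Jet₂ × E)) j :=
    contDiffAt_id.prodMk contDiffAt_fst
  have hval : ContDiffAt ℝ ∞ (fun j : Jet₂ ↦ chrTaylor (j, j.1)) j :=
    ContDiffAt.comp (g := chrTaylor (E := E)) (f := fun j : Jet₂ ↦ ((j, j.1) : Jet₂ × E)) j hΨ hι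
  have hder : ContDiffAt ℝ ∞ (fun j : Jet₂ ↦ fderiv ℝ (fun y ↦ chrTaylor (j, y)) j.1) j :=
    ContDiffAt.fderiv (f := fun (j : Jet₂) (y : E) ↦ chrTaylor (j, y)) (g := fun j : Jet₂ ↦ j.1)
      hΨ contDiffAt_fst (by simp)
  refine (ContDiffAt.sum fun i _ ↦ ?_).contDiffWithinAt
  refine (b.coord i).toContinuousLinearMap.contDiff.contDiffAt.comp j ?_
  refine (((?_ : ContDiffAt ℝ ∞ _ j).sub ?_).add ?_).sub ?_
  · exact ((hder.clm_apply contDiffAt_const).clm_apply contDiffAt_const).clm_apply contDiffAt_const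
  · exact ((hder.clm_apply contDiffAt_const).clm_apply contDiffAt_const).clm_apply contDiffAt_const
  · exact (hval.clm_apply contDiffAt_const).clm_apply
      ((hval.clm_apply contDiffAt_const).clm_apply contDiffAt_const)
  · exact (hval.clm_apply contDiffAt_const).clm_apply
      ((hval.clm_apply contDiffAt_const).clm_apply contDiffAt_const)

end MetricCoord

end Literature.Geometry.Lorentzian

end
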